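import Literature.Analysis.FluidPDE.OseenFlatComplex
import Mathlib.Analysis.SpecialFunctions.JapaneseBracket
import HarnessLib

/-!
# Flat complex Oseen potentials: holomorphy in the complex point, measurability in time

Analysis/FluidPDE proofs-layer companion (theorems only) of `OseenFlatComplex.lean`, for the
proof of the named fact
`Literature.Analysis.FluidPDE.bradshawGrujicKukavica2015_local_analyticity_radius`
(Bradshaw–Grujić–Kukavica 2015, Thm. 2.3; Grujić–Kukavica 1998, §2: "the iterates are entire /
holomorphic on the regions `Ω_t`"). For bounded measurable real densities:

* `differentiableOn_oseenFlatC` — **holomorphy of the flat Oseen potential**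
  `ζ ↦ oseenFlatC ρ u v ζ` (`ρ > 0`) on every open set of points `cx x + i cx y` with `x` in a unit
  ball and `‖y‖ ≤ Y`: holomorphy of dominated parameter integrals, the integrand being entire in
  `ζ` and dominated, uniformly on small balls, by a constant on a compact `w`-region (joint
  continuity of the complexified kernel) plus the off-diagonal sector tail
  `C (25ρ²/6 + ‖x₀ - w‖²/4)^{-(d+1)/2}` (`OseenKernelSectorBounds.lean`), which is integrable;
* `aestronglyMeasurable_oseenFlatC_time` — measurability of `s ↦ oseenFlatC √(t-s) (u s) (v s) ζ`
  on `(s₀, t)` for jointly measurable slab densities (the kernel is jointly continuous in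
  `(m, ξ, a, b)` on `m ≠ 0`);
* `differentiableOn_oseenDuhamelFlatC` — **holomorphy of the flat Duhamel term** under an
  integrable-in-time domination hypothesis on the flat potentials (supplied, along the scheme, by
  the deformed-contour bound, and for annular data by the off-diagonal bound).

## References

* Z. Grujić, I. Kukavica, J. Funct. Anal. 152 (1998), §2. [GrujicKukavica1998]
* Z. Bradshaw, Z. Grujić, I. Kukavica, J. Differential Equations 259 (2015), §3. [BradshawGrujicKukavica2015]
-/

noncomputable section

open MeasureTheory Set Function Filter Metric Real
open _root_.Topology
open scoped BigOperators ENNReal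

namespace Literature.Analysis.FluidPDE

open Literature.Analysis.FunctionSpaces.EuclideanSpace (complexify complexify_apply norm_complexify
  continuous_complexify)

variable {ι : Type*} [Fintype ι]

/-! ### Pointwise tools -/

/-- The flat integrand is entire in the complex point (`ρ ≠ 0`). [folklore] -/
theorem differentiableAt_oseenFlatC_integrand {ρ : ℝ} (hρ : ρ ≠ 0) (c a b ζ : EuclideanSpace ℂ ι) :
    DifferentiableAt ℂ (fun ξ : EuclideanSpace ℂ ι => oseenKernelC (ρ : ℂ) (ξ - c) a b) ζ :=
  (differentiableAt_const _).oseenKernelC (differentiableAt_id.sub_const c) (differentiableAt_const _)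
    (differentiableAt_const _) (Complex.ofReal_ne_zero.2 hρ)

/-- **A uniform bound for the complexified kernel on compact sets** (`ρ ≠ 0`): for compact sets of
complex points and of real base points and bounded tensor slots. [folklore] -/
theorem exists_forall_norm_oseenKernelC_le_of_isCompact {ρ : ℝ} (hρ : ρ ≠ 0)
    {S : Set (EuclideanSpace ℂ ι)} (hS : IsCompact S) (x₀ : EuclideanSpace ℝ ι) (R Mu Mv : ℝ) :
    ∃ B : ℝ, 0 ≤ B ∧ ∀ ζ ∈ S, ∀ w ∈ closedBall x₀ R, ∀ a : EuclideanSpace ℂ ι, ‖a‖ ≤ Mu →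
      ∀ b : EuclideanSpace ℂ ι, ‖b‖ ≤ Mv → ‖oseenKernelC (ρ : ℂ) (ζ - complexify w) a b‖ ≤ B := by
  set T : Set (EuclideanSpace ℂ ι × EuclideanSpace ℝ ι × EuclideanSpace ℂ ι × EuclideanSpace ℂ ι) :=
    S ×ˢ (closedBall x₀ R ×ˢ (closedBall 0 Mu ×ˢ closedBall 0 Mv)) with hT
  have hTc : IsCompact T := hS.prod ((isCompact_closedBall _ _).prod
    ((isCompact_closedBall _ _).prod (isCompact_closedBall _ _)))
  have hcont : Continuous fun q : EuclideanSpace ℂ ι × EuclideanSpace ℝ ι × EuclideanSpace ℂ ι ×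
      EuclideanSpace ℂ ι => oseenKernelC (ρ : ℂ) (q.1 - complexify q.2.1) q.2.2.1 q.2.2.2 := by
    have hd : Differentiable ℂ fun r : EuclideanSpace ℂ ι × EuclideanSpace ℂ ι × EuclideanSpace ℂ ι =>
        oseenKernelC (ρ : ℂ) r.1 r.2.1 r.2.2 := fun r =>
      (differentiableAt_const _).oseenKernelC differentiableAt_fst differentiableAt_snd.fst
        differentiableAt_snd.snd (Complex.ofReal_ne_zero.2 hρ)
    have hmap : Continuous fun q : EuclideanSpace ℂ ι × EuclideanSpace ℝ ι × EuclideanSpace ℂ ι ×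
        EuclideanSpace ℂ ι => ((q.1 - complexify q.2.1, q.2.2.1, q.2.2.2) :
          EuclideanSpace ℂ ι × EuclideanSpace ℂ ι × EuclideanSpace ℂ ι) :=
      (continuous_fst.sub (continuous_complexify.comp (continuous_fst.comp continuous_snd))).prodMk
        ((continuous_fst.comp (continuous_snd.comp continuous_snd)).prodMk
          (continuous_snd.comp (continuous_snd.comp continuous_snd)))
    have h := hd.continuous.comp' hmap
    dsimp only at h
    exact h
  obtain ⟨B, hB⟩ := hTc.exists_bound_of_continuousOn hcont.continuousOn
  refine ⟨max B 0, le_max_right _ _, fun ζ hζ w hw a ha b hb => ?_⟩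
  have hmem : ((ζ, w, a, b) : EuclideanSpace ℂ ι × EuclideanSpace ℝ ι × EuclideanSpace ℂ ι ×
      EuclideanSpace ℂ ι) ∈ T :=
    ⟨hζ, hw, mem_closedBall_zero_iff.2 ha, mem_closedBall_zero_iff.2 hb⟩
  exact (hB _ hmem).trans (le_max_left _ _)

/-- **The sector tail is integrable**: `w ↦ (a + ‖x₀ - w‖²/4)^{-(d+1)/2}` is integrable on `ℝ^ι`
for `a > 0`. [folklore] -/
theorem integrable_sector_tail {a : ℝ} (ha : 0 < a) (x₀ : EuclideanSpace ℝ ι) :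
    Integrable fun w : EuclideanSpace ℝ ι =>
      (a + ‖x₀ - w‖ ^ 2 / 4) ^ (-(((Module.finrank ℝ (EuclideanSpace ℝ ι) : ℝ) + 1) / 2)) := by
  set d : ℝ := (Module.finrank ℝ (EuclideanSpace ℝ ι) : ℝ) with hd
  set q : ℝ := (d + 1) / 2 with hq
  have hq0 : 0 < q := by rw [hq]; positivity
  set c₀ : ℝ := min a (1 / 4) with hc₀
  have hc₀0 : 0 < c₀ := lt_min ha (by norm_num)
  -- comparison with the Japanese bracket
  have hqe : -(d + 1) / 2 = -q := by rw [hq]; ring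
  have hcmp : ∀ w : EuclideanSpace ℝ ι, (a + ‖x₀ - w‖ ^ 2 / 4) ^ (-q) ≤
      c₀ ^ (-q) * (1 + ‖x₀ - w‖ ^ 2) ^ (-q) := by
    intro w
    have h1 : c₀ * (1 + ‖x₀ - w‖ ^ 2) ≤ a + ‖x₀ - w‖ ^ 2 / 4 := by
      have := min_le_left a (1 / 4)
      have := min_le_right a (1 / 4)
      nlinarith [sq_nonneg ‖x₀ - w‖]
    have h2 : (a + ‖x₀ - w‖ ^ 2 / 4) ^ (-q) ≤ (c₀ * (1 + ‖x₀ - w‖ ^ 2)) ^ (-q) :=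
      Real.rpow_le_rpow_of_nonpos (by positivity) h1 (by linarith)
    refine h2.trans_eq ?_
    rw [Real.mul_rpow hc₀0.le (by positivity)]
  have hJ : Integrable fun w : EuclideanSpace ℝ ι => (1 + ‖x₀ - w‖ ^ 2) ^ (-q) := by
    have h := (integrable_rpow_neg_one_add_norm_sq (E := EuclideanSpace ℝ ι) (μ := volume)
      (r := d + 1) (by rw [hd]; linarith)).comp_sub_left x₀
    rw [hqe] at h
    exact h
  refine ((hJ.const_mul (c₀ ^ (-q))).mono' ?_ (Eventually.of_forall fun w => ?_))
  · refine (Measurable.aestronglyMeasurable ?_)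
    fun_prop
  · rw [Real.norm_of_nonneg (Real.rpow_nonneg (by positivity) _)]
    exact hcmp w

/-! ### Holomorphy of the flat potential -/

/-- **Holomorphy of the flat Oseen potential.** For measurable densities bounded by `M_u, M_v`,
`ρ > 0`, and an open set `V` of points `cx x + i cx y` with `‖x - x₀‖ ≤ 1`, `‖y‖ ≤ Y`, the map
`ζ ↦ oseenFlatC ρ u v ζ` is holomorphic on `V`. [cite: GrujicKukavica1998, §2] -/
theorem differentiableOn_oseenFlatC {u v : EuclideanSpace ℝ ι → EuclideanSpace ℝ ι}
    (hu : AEStronglyMeasurable u volume) (hv : AEStronglyMeasurable v volume)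
    {Mu Mv : ℝ} (hMu : 0 ≤ Mu) (hMv : 0 ≤ Mv) (huM : ∀ w, ‖u w‖ ≤ Mu) (hvM : ∀ w, ‖v w‖ ≤ Mv)
    {ρ : ℝ} (hρ : 0 < ρ) (x₀ : EuclideanSpace ℝ ι) {Y : ℝ} (hY : 0 ≤ Y)
    {V : Set (EuclideanSpace ℂ ι)} (hV : IsOpen V)
    (hadm : ∀ ζ ∈ V, ∃ x y : EuclideanSpace ℝ ι,
      ζ = complexify x + Complex.I • complexify y ∧ ‖x - x₀‖ ≤ 1 ∧ ‖y‖ ≤ Y) :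
    DifferentiableOn ℂ (oseenFlatC ρ u v) V := by
  set d : ℝ := (Module.finrank ℝ (EuclideanSpace ℝ ι) : ℝ) with hd
  obtain ⟨C, hC, hK⟩ := exists_norm_oseenKernelC_imShift_le (ι := ι)
  show DifferentiableOn ℂ (fun ζ => ∫ w, oseenKernelC (ρ : ℂ) (ζ - complexify w) (complexify (u w))
    (complexify (v w))) V
  refine Literature.Analysis.Complex.differentiableOn_integral_of_dominated
    (F := fun ζ w => oseenKernelC (ρ : ℂ) (ζ - complexify w) (complexify (u w)) (complexify (v w)))
    ?_ ?_ ?_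
  · exact fun ζ _ => aestronglyMeasurable_oseenFlatC_integrand hu hv hρ.ne' ζ
  · exact Eventually.of_forall fun w ζ _ =>
      (differentiableAt_oseenFlatC_integrand hρ.ne' (complexify w) _ _ ζ).differentiableWithinAt
  · intro ζ₀ hζ₀
    obtain ⟨R₀, hR₀, hball₀⟩ := Metric.isOpen_iff.1 hV ζ₀ hζ₀
    set R : ℝ := min R₀ 1 with hR
    have hR0 : 0 < R := lt_min hR₀ one_pos
    have hball : ball ζ₀ R ⊆ V := (ball_subset_ball (min_le_left _ _)).trans hball₀
    -- the near-region constant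
    obtain ⟨B, hB0, hB⟩ := exists_forall_norm_oseenKernelC_le_of_isCompact hρ.ne'
      (isCompact_closedBall ζ₀ 1) x₀ (2 * Y + 3) Mu Mv
    -- the majorant
    set tail : EuclideanSpace ℝ ι → ℝ := fun w =>
      (25 / 6 * ρ ^ 2 + ‖x₀ - w‖ ^ 2 / 4) ^ (-((d + 1) / 2)) with htail
    refine ⟨R, hR0, hball, fun w => (closedBall x₀ (2 * Y + 3)).indicator (fun _ => B) w +
      C * tail w * Mu * Mv, ?_, Eventually.of_forall fun w ζ hζ => ?_⟩
    · refine ((integrable_indicator_iff measurableSet_closedBall).2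
        (integrableOn_const (isCompact_closedBall _ _).measure_lt_top.ne)).add ?_
      have ht := integrable_sector_tail (ι := ι) (show (0 : ℝ) < 25 / 6 * ρ ^ 2 by positivity) x₀
      rw [← hd] at ht
      have ht' : Integrable (fun w => C * Mu * Mv * tail w) := ht.const_mul _
      exact ht'.congr (Eventually.of_forall fun w => by ring)
    · show ‖oseenKernelC (ρ : ℂ) (ζ - complexify w) (complexify (u w)) (complexify (v w))‖ ≤
        (closedBall x₀ (2 * Y + 3)).indicator (fun _ => B) w + C * tail w * Mu * Mv
      obtain ⟨x, y, rfl, hx, hy⟩ := hadm ζ (hball hζ)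
      have hζ1 : complexify x + Complex.I • complexify y ∈ closedBall ζ₀ 1 :=
        (ball_subset_closedBall.trans (closedBall_subset_closedBall (min_le_right _ _))) hζ
      by_cases hw : w ∈ closedBall x₀ (2 * Y + 3)
      · -- near region: the compact bound
        rw [Set.indicator_of_mem hw]
        have h1 := hB _ hζ1 w hw (complexify (u w)) (by rw [norm_complexify]; exact huM w)
          (complexify (v w)) (by rw [norm_complexify]; exact hvM w)
        have h2 : 0 ≤ C * tail w * Mu * Mv := by
          have : 0 ≤ tail w := Real.rpow_nonneg (by positivity) _
          positivity
        linarith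
      · -- far region: the sector bound
        rw [Set.indicator_of_notMem hw, zero_add]
        have hfar : 2 * Y + 3 < ‖x₀ - w‖ := by
          have : ¬ dist w x₀ ≤ 2 * Y + 3 := hw
          rw [dist_eq_norm, ← norm_neg, neg_sub] at this
          linarith
        have hxw : ‖x₀ - w‖ - 1 ≤ ‖x - w‖ := by
          have := norm_sub_norm_le (x₀ - w) (x - w)
          rw [show x₀ - w - (x - w) = -(x - x₀) by abel, norm_neg] at this
          linarith
        have hadm' : ‖-y‖ ≤ ‖x - w‖ / 2 + ρ := by
          rw [norm_neg]; linarith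
        rw [complexify_add_I_smul_sub']
        have hKw := hK hρ hadm' (complexify (u w)) (complexify (v w))
        rw [← hd, norm_complexify, norm_complexify] at hKw
        refine hKw.trans ?_
        have hpow : (25 / 6 * ρ ^ 2 + ‖x - w‖ ^ 2) ^ (-((d + 1) / 2)) ≤ tail w := by
          rw [htail]
          refine Real.rpow_le_rpow_of_nonpos (by positivity) ?_ (by
            have : (0 : ℝ) ≤ d := by rw [hd]; positivity
            linarith)
          have h2 : ‖x₀ - w‖ / 2 ≤ ‖x - w‖ := by linarith
          have h3 : ‖x₀ - w‖ ^ 2 / 4 ≤ ‖x - w‖ ^ 2 := by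
            have h0 : 0 ≤ ‖x₀ - w‖ / 2 := by positivity
            nlinarith
          linarith
        calc C * (25 / 6 * ρ ^ 2 + ‖x - w‖ ^ 2) ^ (-((d + 1) / 2)) * ‖u w‖ * ‖v w‖
            ≤ C * tail w * Mu * Mv := by
              gcongr
              · exact huM w
              · exact hvM w

/-! ### Measurability in time -/

/-- On `ℝ × ℝ^ι`, restricting Lebesgue measure to a time slab is the product of the restricted
time measure with Lebesgue measure in space. [folklore] -/
theorem volume_restrict_prod_univ (S : Set ℝ) :
    ((volume : Measure (ℝ × EuclideanSpace ℝ ι)).restrict (S ×ˢ univ)) =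
      ((volume : Measure ℝ).restrict S).prod (volume : Measure (EuclideanSpace ℝ ι)) := by
  rw [Measure.volume_eq_prod, ← Measure.restrict_univ (μ := (volume : Measure (EuclideanSpace ℝ ι))),
    Measure.prod_restrict, Measure.restrict_univ]

/-- **Joint measurability of the flat time–space integrand** on `(s₀, t) × ℝ^ι` for jointly
measurable slab densities (the complexified kernel is jointly continuous in `(m, ξ, a, b)` on
`m ≠ 0`, and `√(t-s) ≠ 0` on the slab). [folklore] -/
theorem aestronglyMeasurable_oseenFlatC_integrand_timeSpace {u v : ℝ → EuclideanSpace ℝ ι → EuclideanSpace ℝ ι}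
    {s₀ t : ℝ}
    (hu : AEStronglyMeasurable (uncurry u)
      ((volume : Measure (ℝ × EuclideanSpace ℝ ι)).restrict (Ioo s₀ t ×ˢ univ)))
    (hv : AEStronglyMeasurable (uncurry v)
      ((volume : Measure (ℝ × EuclideanSpace ℝ ι)).restrict (Ioo s₀ t ×ˢ univ)))
    (ζ : EuclideanSpace ℂ ι) :
    AEStronglyMeasurable (fun z : ℝ × EuclideanSpace ℝ ι =>
      oseenKernelC ((Real.sqrt (t - z.1) : ℝ) : ℂ) (ζ - complexify z.2) (complexify (u z.1 z.2))
        (complexify (v z.1 z.2)))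
      (((volume : Measure ℝ).restrict (Ioo s₀ t)).prod (volume : Measure (EuclideanSpace ℝ ι))) := by
  classical
  set μ : Measure (ℝ × EuclideanSpace ℝ ι) :=
    ((volume : Measure ℝ).restrict (Ioo s₀ t)).prod (volume : Measure (EuclideanSpace ℝ ι)) with hμ
  have hμ' : μ = (volume : Measure (ℝ × EuclideanSpace ℝ ι)).restrict (Ioo s₀ t ×ˢ univ) := by
    rw [hμ, volume_restrict_prod_univ]
  -- a root time which never vanishes and agrees with `√(t-s)` on the slab
  set m : ℝ → ℝ := fun s => if s < t then Real.sqrt (t - s) else 1 with hm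
  have hm_meas : Measurable m := Measurable.ite measurableSet_Iio (by fun_prop) measurable_const
  have hm_ne : ∀ s, (m s : ℂ) ≠ 0 := fun s => by
    rw [hm]; by_cases hs : s < t
    · simp only [hs, if_true]; exact Complex.ofReal_ne_zero.2 (Real.sqrt_pos.2 (sub_pos.2 hs)).ne'
    · simp only [hs, if_false]; exact one_ne_zero
  -- the continuous kernel on `{m ≠ 0}` composed with a measurable map into it
  set U : Set (ℂ × EuclideanSpace ℂ ι × EuclideanSpace ℂ ι × EuclideanSpace ℂ ι) := {q | q.1 ≠ 0} with hU
  set f : ℝ × EuclideanSpace ℝ ι → ℂ × EuclideanSpace ℂ ι × EuclideanSpace ℂ ι × EuclideanSpace ℂ ι :=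
    fun z => ((m z.1 : ℂ), ζ - complexify z.2, complexify (u z.1 z.2), complexify (v z.1 z.2)) with hf
  have hfU : ∀ z, f z ∈ U := fun z => hm_ne z.1
  have hf_meas : AEMeasurable f μ := by
    have h1 : AEMeasurable (fun z : ℝ × EuclideanSpace ℝ ι => (m z.1 : ℂ)) μ :=
      (Complex.measurable_ofReal.comp (hm_meas.comp measurable_fst)).aemeasurable
    have h2 : AEMeasurable (fun z : ℝ × EuclideanSpace ℝ ι => ζ - complexify z.2) μ :=
      (continuous_const.sub (continuous_complexify.comp continuous_snd)).measurable.aemeasurable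
    have h3 : AEMeasurable (fun z : ℝ × EuclideanSpace ℝ ι => complexify (u z.1 z.2)) μ := by
      rw [hμ']; exact (continuous_complexify.comp_aestronglyMeasurable hu).aemeasurable
    have h4 : AEMeasurable (fun z : ℝ × EuclideanSpace ℝ ι => complexify (v z.1 z.2)) μ := by
      rw [hμ']; exact (continuous_complexify.comp_aestronglyMeasurable hv).aemeasurable
    exact h1.prodMk (h2.prodMk (h3.prodMk h4))
  have hfr : AEStronglyMeasurable (codRestrict f U hfU) μ :=
    (hf_meas.subtype_mk (hfs := hfU)).aestronglyMeasurable
  have hKc : Continuous (U.restrict fun q : ℂ × EuclideanSpace ℂ ι × EuclideanSpace ℂ ι ×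
      EuclideanSpace ℂ ι => oseenKernelC q.1 q.2.1 q.2.2.1 q.2.2.2) :=
    continuousOn_iff_continuous_restrict.1 continuousOn_oseenKernelC
  have hcomp := hKc.comp_aestronglyMeasurable hfr
  have hcomp' : AEStronglyMeasurable (fun z : ℝ × EuclideanSpace ℝ ι =>
      oseenKernelC (m z.1 : ℂ) (ζ - complexify z.2) (complexify (u z.1 z.2)) (complexify (v z.1 z.2))) μ :=
    hcomp.congr (Eventually.of_forall fun z => rfl)
  -- agreement with `√(t-s)` on the slab
  refine hcomp'.congr ?_
  have hae : ∀ᵐ z ∂μ, z.1 ∈ Ioo s₀ t := by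
    rw [hμ', ae_restrict_iff' (measurableSet_Ioo.prod MeasurableSet.univ)]
    exact Eventually.of_forall fun z hz => hz.1
  filter_upwards [hae] with z hz
  simp only [hm, hz.2, if_true]

/-- **Measurability in time of the flat potentials** `s ↦ oseenFlatC √(t-s) (u s) (v s) ζ` on
`(s₀, t)` for jointly measurable slab densities. [folklore] -/
theorem aestronglyMeasurable_oseenFlatC_time {u v : ℝ → EuclideanSpace ℝ ι → EuclideanSpace ℝ ι}
    {s₀ t : ℝ}
    (hu : AEStronglyMeasurable (uncurry u)
      ((volume : Measure (ℝ × EuclideanSpace ℝ ι)).restrict (Ioo s₀ t ×ˢ univ)))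
    (hv : AEStronglyMeasurable (uncurry v)
      ((volume : Measure (ℝ × EuclideanSpace ℝ ι)).restrict (Ioo s₀ t ×ˢ univ)))
    (ζ : EuclideanSpace ℂ ι) :
    AEStronglyMeasurable (fun s => oseenFlatC (Real.sqrt (t - s)) (u s) (v s) ζ)
      ((volume : Measure ℝ).restrict (Ioo s₀ t)) := by
  have h := (aestronglyMeasurable_oseenFlatC_integrand_timeSpace hu hv ζ).integral_prod_right'
  exact h.congr (Eventually.of_forall fun s => rfl)

/-! ### Holomorphy of the flat Duhamel term -/

/-- **Holomorphy of the flat Oseen–Duhamel term.** For jointly measurable slab densities bounded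
by `M` on `(s₀, t) × ℝ^ι`, an open set `V` of points `cx x + i cx y` with `‖x - x₀‖ ≤ 1`, `‖y‖ ≤ Y`,
and an integrable-in-time domination `‖oseenFlatC √(t-s) (u s) (v s) ζ‖ ≤ bound s` on `V × (s₀,t)`,
the map `ζ ↦ oseenDuhamelFlatC s₀ u v t ζ` is holomorphic on `V`. [cite: GrujicKukavica1998, §2] -/
theorem differentiableOn_oseenDuhamelFlatC {u v : ℝ → EuclideanSpace ℝ ι → EuclideanSpace ℝ ι}
    {s₀ t : ℝ}
    (hu : AEStronglyMeasurable (uncurry u)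
      ((volume : Measure (ℝ × EuclideanSpace ℝ ι)).restrict (Ioo s₀ t ×ˢ univ)))
    (hv : AEStronglyMeasurable (uncurry v)
      ((volume : Measure (ℝ × EuclideanSpace ℝ ι)).restrict (Ioo s₀ t ×ˢ univ)))
    {M : ℝ} (hM : 0 ≤ M) (huM : ∀ s ∈ Ioo s₀ t, ∀ w, ‖u s w‖ ≤ M) (hvM : ∀ s ∈ Ioo s₀ t, ∀ w, ‖v s w‖ ≤ M)
    (x₀ : EuclideanSpace ℝ ι) {Y : ℝ} (hY : 0 ≤ Y) {V : Set (EuclideanSpace ℂ ι)} (hV : IsOpen V)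
    (hadm : ∀ ζ ∈ V, ∃ x y : EuclideanSpace ℝ ι,
      ζ = complexify x + Complex.I • complexify y ∧ ‖x - x₀‖ ≤ 1 ∧ ‖y‖ ≤ Y)
    {bound : ℝ → ℝ} (hbi : IntegrableOn bound (Ioo s₀ t))
    (hdom : ∀ ζ ∈ V, ∀ s ∈ Ioo s₀ t, ‖oseenFlatC (Real.sqrt (t - s)) (u s) (v s) ζ‖ ≤ bound s) :
    DifferentiableOn ℂ (oseenDuhamelFlatC s₀ u v t) V := by
  set μ : Measure ℝ := (volume : Measure ℝ).restrict (Ioo s₀ t) with hμ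
  have hae : ∀ᵐ s ∂μ, s ∈ Ioo s₀ t := by rw [hμ]; exact ae_restrict_mem measurableSet_Ioo
  -- sections of the slab densities are measurable for a.e. time
  have hprod : ((volume : Measure (ℝ × EuclideanSpace ℝ ι)).restrict (Ioo s₀ t ×ˢ univ)) =
      μ.prod (volume : Measure (EuclideanSpace ℝ ι)) := by rw [hμ, volume_restrict_prod_univ]
  have hus : ∀ᵐ s ∂μ, AEStronglyMeasurable (u s) volume := by
    have h := hu; rw [hprod] at h
    filter_upwards [h.prodMk_left] with s hs using hs
  have hvs : ∀ᵐ s ∂μ, AEStronglyMeasurable (v s) volume := by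
    have h := hv; rw [hprod] at h
    filter_upwards [h.prodMk_left] with s hs using hs
  show DifferentiableOn ℂ (fun ζ => ∫ s in Ioo s₀ t, oseenFlatC (Real.sqrt (t - s)) (u s) (v s) ζ) V
  refine Literature.Analysis.Complex.differentiableOn_integral_of_dominated (μ := μ)
    (F := fun ζ s => oseenFlatC (Real.sqrt (t - s)) (u s) (v s) ζ) ?_ ?_ ?_
  · exact fun ζ _ => aestronglyMeasurable_oseenFlatC_time hu hv ζ
  · filter_upwards [hae, hus, hvs] with s hs hus' hvs'
    exact differentiableOn_oseenFlatC hus' hvs' hM hM (huM s hs) (hvM s hs)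
      (Real.sqrt_pos.2 (sub_pos.2 hs.2)) x₀ hY hV hadm
  · intro ζ₀ hζ₀
    obtain ⟨R, hR, hball⟩ := Metric.isOpen_iff.1 hV ζ₀ hζ₀
    refine ⟨R, hR, hball, bound, hbi, ?_⟩
    filter_upwards [hae] with s hs ζ hζ
    exact hdom ζ (hball hζ) s hs

end Literature.Analysis.FluidPDE
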